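import Mathlib
import Summits.ValiantsHypothesis.ValiantsHypothesis.Theorems.BarrierLeverPartitionMinorsHitByVPHiddenStatesSecondShellTwoTops
import Summits.ValiantsHypothesis.ValiantsHypothesis.Theorems.BarrierLeverPartitionMinorsHitByVPHiddenStatesOneUnfed

/-!
# Route BarrierLever — item `PartitionMinorsHitByVP` (stmt-ValiantsHypothesis-19717), line `hidden-states`:
# ★★ ORIENTED SECOND-SHELL CELLS — trapped bottoms and funnels (every `t, h`)

Helper file (`--supports stmt-ValiantsHypothesis-19717`; cell valiant-natproofs, 𝒟-side door (c), registered line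
`Cruxes/PartitionMinorsHitByVP/Lines/hidden_states.lean` v8; prover seat val-np-p6 gen 17).  Closes NO item; definition-free.

Two more TABLE-FREE second-shell families served by the exchange composition, using transports with a prescribed TOP, BOTTOM and LEVEL-0
ATTACHMENTS (`exists_equiv_four_oriented`; the bottom's sources are its level-0 attachments, `swapTable'_bottom_row`):
* ★★ `exists_table_secondShell_trappedBottom` — `b ∈ (C₂∖A₂) ∖ (A₁ ∪ C₁)` at the bottom of path 2 whose level-0 attachments
  `s, s' ∈ (A₂∖C₂) ∖ (A₁ ∪ C₁)` (`s ≠ s'` when `|A₂∖C₂| ≥ 2`): the token of `C₂` at `b` is trapped in `{b, s, s'}`, disjoint from `A₁`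
  (`…SecondShellTrapped.det_eq_zero_of_trapped`);
* ★★ `exists_table_secondShell_funnel` — a shared top `y ∈ (C₁∖A₁) ∩ (C₂∖A₂)`, the bottom of path 1 at `b ∈ (C₁∖A₁) ∩ A₂ ∩ C₂` with
  level-0 attachments `s, s' ∈ (A₁∖C₁) ∩ A₂ ∩ C₂`: THEOREM 1UZ (`…OneUnfed.det_eq_zero_of_one_unfed_fwd`) with `q = y`, `F = {b, s, s'}`.
Census (lab/funnel.py, memo §4): on top of the immobile-token and two-tops cells these serve 1 890 + 630 further families at `t = 3`.

HONEST LABEL: conjecture-column cells (second shell, every `t, h`); 19717 stays OPEN; nothing on crux 14610 or VP ≠ VNP.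
-/

set_option linter.dupNamespace false

namespace Summit.ValiantsHypothesis.ValiantsHypothesis.Theorems.BarrierLever.HiddenStates

open Finset

noncomputable section

namespace SecondShell

open PathTable

variable {α : Type} [Fintype α] [DecidableEq α]

/-! ## Permutations with prescribed values; oriented transports -/

/-- a permutation of a finite type with two prescribed values. -/
theorem exists_perm_two {β : Type} [DecidableEq β] {i₁ i₂ a₁ a₂ : β} (hi : i₁ ≠ i₂) (ha : a₁ ≠ a₂) :
    ∃ σ : Equiv.Perm β, σ i₁ = a₁ ∧ σ i₂ = a₂ := by
  classical
  let τ₁ : Equiv.Perm β := Equiv.swap i₁ a₁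
  let τ₂ : Equiv.Perm β := Equiv.swap i₂ (τ₁ a₂)
  refine ⟨τ₂.trans τ₁, ?_, ?_⟩
  · have hne' : τ₁ a₂ ≠ i₁ := by
      intro h
      have h' := congrArg τ₁ h
      simp only [τ₁, Equiv.swap_apply_self, Equiv.swap_apply_left] at h'
      exact ha h'.symm
    show τ₁ (τ₂ i₁) = a₁
    rw [show τ₂ i₁ = i₁ from Equiv.swap_apply_of_ne_of_ne hi (Ne.symm hne')]
    exact Equiv.swap_apply_left _ _
  · show τ₁ (τ₂ i₂) = a₂
    rw [show τ₂ i₂ = τ₁ a₂ from Equiv.swap_apply_left _ _]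
    exact Equiv.swap_apply_self _ _ _

/-- a permutation with one prescribed value. -/
theorem exists_perm_one {β : Type} [DecidableEq β] (i a : β) : ∃ σ : Equiv.Perm β, σ i = a :=
  ⟨Equiv.swap i a, Equiv.swap_apply_left _ _⟩

/-- ★ **oriented transport**: prescribed top `y`, bottom `b` of the Y-path and level-0 attachment `s` (and `s'` when `k ≥ 2`). -/
theorem exists_equiv_four_oriented (A C : Finset α) {k j j' : ℕ} (hk : 1 ≤ k)
    (h1 : (C \ A).card = k + 1) (h2 : (A \ C).card = k) (h3 : (A ∩ C).card = j) (h4 : (A ∪ C)ᶜ.card = j')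
    {y b s s' : α} (hy : y ∈ C \ A) (hb : b ∈ C \ A) (hyb : y ≠ b) (hs : s ∈ A \ C) (hs' : s' ∈ A \ C) (hss' : 2 ≤ k → s ≠ s') :
    ∃ e : (Fin (k + 1) ⊕ Fin k) ⊕ (Fin j ⊕ Fin j') ≃ α,
      (∀ x, e (Sum.inl (Sum.inl x)) ∈ C \ A) ∧ (∀ i, e (Sum.inl (Sum.inr i)) ∈ A \ C) ∧
      (∀ z, e (Sum.inr (Sum.inl z)) ∈ A ∩ C) ∧ (∀ w, e (Sum.inr (Sum.inr w)) ∈ (A ∪ C)ᶜ) ∧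
      e (Sum.inl (Sum.inl (Fin.last k))) = y ∧ e (Sum.inl (Sum.inl 0)) = b ∧
      e (Sum.inl (Sum.inr ⟨0, by omega⟩)) = s ∧ (∀ h2 : 2 ≤ k, e (Sum.inl (Sum.inr ⟨1, by omega⟩)) = s') := by
  classical
  obtain ⟨e, m1, m2, m3, m4⟩ := exists_equiv_four' A C h1 h2 h3 h4
  have hYblock : ∀ x : α, x ∈ C \ A → ∃ i, e.symm x = Sum.inl (Sum.inl i) := by
    intro x hx
    rcases hex : e.symm x with (i | i) | (z | w')
    · exact ⟨i, rfl⟩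
    · exfalso; have := m2 i; rw [← hex, Equiv.apply_symm_apply] at this
      rw [Finset.mem_sdiff] at hx this; exact this.2 hx.1
    · exfalso; have := m3 z; rw [← hex, Equiv.apply_symm_apply] at this
      rw [Finset.mem_sdiff] at hx; rw [Finset.mem_inter] at this; exact hx.2 this.1
    · exfalso; have := m4 w'; rw [← hex, Equiv.apply_symm_apply] at this
      rw [Finset.mem_sdiff] at hx; rw [Finset.mem_compl, Finset.mem_union] at this; exact this (Or.inr hx.1)
  have hXblock : ∀ x : α, x ∈ A \ C → ∃ i, e.symm x = Sum.inl (Sum.inr i) := by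
    intro x hx
    rcases hex : e.symm x with (i | i) | (z | w')
    · exfalso; have := m1 i; rw [← hex, Equiv.apply_symm_apply] at this
      rw [Finset.mem_sdiff] at hx this; exact this.2 hx.1
    · exact ⟨i, rfl⟩
    · exfalso; have := m3 z; rw [← hex, Equiv.apply_symm_apply] at this
      rw [Finset.mem_sdiff] at hx; rw [Finset.mem_inter] at this; exact hx.2 this.2
    · exfalso; have := m4 w'; rw [← hex, Equiv.apply_symm_apply] at this
      rw [Finset.mem_sdiff] at hx; rw [Finset.mem_compl, Finset.mem_union] at this; exact this (Or.inl hx.1)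
  obtain ⟨iy, hiy⟩ := hYblock y hy
  obtain ⟨ib, hib⟩ := hYblock b hb
  obtain ⟨is, his⟩ := hXblock s hs
  obtain ⟨is', his'⟩ := hXblock s' hs'
  have hiyb : iy ≠ ib := by
    intro h; apply hyb; have := hiy; rw [h, ← hib] at this; exact e.symm.injective this
  have hlast0 : (Fin.last k : Fin (k + 1)) ≠ 0 := by
    intro h; have := congrArg Fin.val h; simp at this; omega
  obtain ⟨σ, hσy, hσb⟩ := exists_perm_two (β := Fin (k + 1)) hlast0 hiyb
  have hρ : ∃ ρ : Equiv.Perm (Fin k), ρ ⟨0, by omega⟩ = is ∧ (∀ h2 : 2 ≤ k, ρ ⟨1, by omega⟩ = is') := by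
    by_cases h2 : 2 ≤ k
    · have hne01 : (⟨0, by omega⟩ : Fin k) ≠ ⟨1, by omega⟩ := by intro h; have := congrArg Fin.val h; simp at this
      have hss : is ≠ is' := by
        intro h; apply hss' h2; have := his; rw [h, ← his'] at this; exact e.symm.injective this
      obtain ⟨ρ, h0, h1'⟩ := exists_perm_two (β := Fin k) hne01 hss
      exact ⟨ρ, h0, fun _ => h1'⟩
    · obtain ⟨ρ, h0⟩ := exists_perm_one (β := Fin k) ⟨0, by omega⟩ is
      exact ⟨ρ, h0, fun h => absurd h h2⟩
  obtain ⟨ρ, hρ0, hρ1⟩ := hρ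
  let e' : (Fin (k + 1) ⊕ Fin k) ⊕ (Fin j ⊕ Fin j') ≃ α :=
    (Equiv.sumCongr (Equiv.sumCongr σ ρ) (Equiv.refl (Fin j ⊕ Fin j'))).trans e
  have he' : ∀ x, e' x = e (Sum.map (Sum.map σ ρ) id x) := fun x => rfl
  refine ⟨e', fun x => ?_, fun i => ?_, fun z => ?_, fun w' => ?_, ?_, ?_, ?_, fun h2 => ?_⟩
  · rw [he']; exact m1 (σ x)
  · rw [he']; exact m2 (ρ i)
  · rw [he']; exact m3 z
  · rw [he']; exact m4 w'
  · rw [he']; show e (Sum.inl (Sum.inl (σ (Fin.last k)))) = y; rw [hσy, ← hiy, Equiv.apply_symm_apply]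
  · rw [he']; show e (Sum.inl (Sum.inl (σ 0))) = b; rw [hσb, ← hib, Equiv.apply_symm_apply]
  · rw [he']; show e (Sum.inl (Sum.inr (ρ ⟨0, _⟩))) = s; rw [hρ0, ← his, Equiv.apply_symm_apply]
  · rw [he']; show e (Sum.inl (Sum.inr (ρ ⟨1, _⟩))) = s'; rw [hρ1 h2, ← his', Equiv.apply_symm_apply]

omit [Fintype α] [DecidableEq α] in
/-- **the bottom row**: the sources of the bottom `b = e(inl (inl 0))` are level-0 attachments `e(inl (inr i))`, `i ≤ 1`. -/
theorem swapTable'_bottom_row {k j j' : ℕ} (e : (Fin (k + 1) ⊕ Fin k) ⊕ (Fin j ⊕ Fin j') ≃ α) {d : α}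
    (hd : swapTable' e (e (Sum.inl (Sum.inl 0))) d ≠ 0) (hne : d ≠ e (Sum.inl (Sum.inl 0))) :
    ∃ i : Fin k, (i : ℕ) ≤ 1 ∧ d = e (Sum.inl (Sum.inr i)) := by
  unfold swapTable' at hd
  rw [Equiv.symm_apply_apply] at hd
  have hne' : e.symm d ≠ Sum.inl (Sum.inl 0) := by
    intro h; apply hne; rw [← h, Equiv.apply_symm_apply]
  rcases hx : e.symm d with (x | i) | z
  · rw [hx] at hd hne'
    simp only [coreTable', pw] at hd
    rw [if_neg (fun h => hne' (by rw [h])), if_neg (by simp)] at hd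
    exact (hd rfl).elim
  · rw [hx] at hd
    simp only [coreTable', pw, lvlX] at hd
    by_cases hi : (i : ℕ) - 1 = ((0 : Fin (k + 1)) : ℕ)
    · refine ⟨i, by simp at hi; omega, ?_⟩
      rw [← hx, Equiv.apply_symm_apply]
    · rw [if_neg hi] at hd; exact (hd rfl).elim
  · rw [hx] at hd; simp [coreTable'] at hd


/-! ## ★★ The trapped-bottom cell -/

/-- ★★ **SECOND SHELL, TRAPPED-BOTTOM CLASSES, EVERY `t, h`.**  `x₀ ∈ (C₂∖A₂)∖(A₁∪C₁)` sits at the bottom of path 2 with level-0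
attachments `s, s' ∈ (A₂∖C₂)∖(A₁∪C₁)` (`s ≠ s'` unless `|A₂∖C₂| ≤ 1`); then the class is served. -/
theorem exists_table_secondShell_trappedBottom (h t : ℕ) (A₁ A₂ C₁ C₂ : Finset (Fin h))
    (hA₁ : A₁.card = t) (hA₂ : A₂.card = t) (hC₁ : C₁.card = t + 1) (hC₂ : C₂.card = t + 1)
    (h₁ : ¬ A₁ ⊆ C₁) (h₂ : ¬ A₂ ⊆ C₂) (hA : A₁ ≠ A₂) (hC : C₁ ≠ C₂)
    {x₀ s s' : Fin h} (hx₁ : x₀ ∈ C₂) (hx₂ : x₀ ∉ A₂) (hx₃ : x₀ ∉ A₁) (hx₄ : x₀ ∉ C₁)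
    (hs₁ : s ∈ A₂) (hs₂ : s ∉ C₂) (hs₃ : s ∉ A₁) (hs₄ : s ∉ C₁)
    (hs'₁ : s' ∈ A₂) (hs'₂ : s' ∉ C₂) (hs'₃ : s' ∉ A₁) (hs'₄ : s' ∉ C₁) (hss' : s ≠ s' ∨ (A₂ \ C₂).card ≤ 1)
    {r : ℕ} (u cols : Fin r → Finset (Fin h)) (hu : Function.Injective u)
    (hU : ∀ i, ((u i).card ≤ t ∧ u i ≠ A₁ ∧ u i ≠ A₂) ∨ u i = C₁ ∨ u i = C₂)
    (hcols : ∀ J : Finset (Fin h), J.card ≤ t → ∃ kk, cols kk = J) :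
    ∃ tx : Option (Fin h) → Fin h → ℂ,
      (Matrix.of fun i kk : Fin r => ∏ a ∈ u i, (tx none a + ∑ q ∈ cols kk, tx (some q) a)).det ≠ 0 := by
  classical
  obtain ⟨k₁, j₁, j₁', hk₁, hkj₁, a1, a2, a3, a4⟩ := swap_sizes A₁ C₁ hA₁ hC₁ h₁
  obtain ⟨k₂, j₂, j₂', hk₂, hkj₂, b1, b2, b3, b4⟩ := swap_sizes A₂ C₂ hA₂ hC₂ h₂
  obtain ⟨e₁, m1, m2, m3, m4⟩ := exists_equiv_four' A₁ C₁ a1 a2 a3 a4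
  -- a top for path 2 other than `x₀`
  obtain ⟨yt, hyt, hytb⟩ : ∃ yt ∈ C₂ \ A₂, yt ≠ x₀ := by
    have hcard : 1 < (C₂ \ A₂).card := by rw [b1]; omega
    obtain ⟨x, hx, y', hy', hxy⟩ := Finset.one_lt_card.1 hcard
    by_cases hxb : x = x₀
    · exact ⟨y', hy', fun h => hxy (hxb.trans h.symm)⟩
    · exact ⟨x, hx, hxb⟩
  have hss'' : 2 ≤ k₂ → s ≠ s' := by
    intro h2; rcases hss' with h | h
    · exact h
    · rw [b2] at h; omega
  obtain ⟨e₂, n1, n2, n3, n4, -, hbot₂, hatt₂, hatt₂'⟩ := exists_equiv_four_oriented A₂ C₂ hk₂ b1 b2 b3 b4 hyt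
    (Finset.mem_sdiff.2 ⟨hx₁, hx₂⟩) hytb (Finset.mem_sdiff.2 ⟨hs₁, hs₂⟩) (Finset.mem_sdiff.2 ⟨hs'₁, hs'₂⟩) hss''
  let N₁ : Fin h → Fin h → ℂ := fun a q => swapTable' e₁ a q - if q = a then 1 else 0
  let N₂ : Fin h → Fin h → ℂ := fun a q => swapTable' e₂ a q - if q = a then 1 else 0
  have hT10 : tab2 N₁ N₂ ![1, 0] = swapTable' e₁ := by funext a q; simp [tab2, N₁]
  have hT01 : tab2 N₁ N₂ ![0, 1] = swapTable' e₂ := by funext a q; simp [tab2, N₂]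
  -- bookkeeping (verbatim from the immobile-token cell)
  set Ball := Finset.univ.filter fun S : Finset (Fin h) => S.card ≤ t with hBall
  set 𝒰 := insert C₁ (insert C₂ ((Ball.erase A₁).erase A₂)) with h𝒰
  have hBA₁ : A₁ ∈ Ball := Finset.mem_filter.2 ⟨Finset.mem_univ _, by omega⟩
  have hBA₂ : A₂ ∈ Ball := Finset.mem_filter.2 ⟨Finset.mem_univ _, by omega⟩
  have hBC₁ : C₁ ∉ Ball := fun h' => by have := (Finset.mem_filter.1 h').2; omega
  have hBC₂ : C₂ ∉ Ball := fun h' => by have := (Finset.mem_filter.1 h').2; omega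
  have h𝒰card : 𝒰.card = Ball.card := card_secondShell_rows Ball hBA₁ hBA₂ hBC₁ hBC₂ hA hC
  have hUmem : ∀ i, u i ∈ 𝒰 := by
    intro i
    rcases hU i with ⟨hc, hne₁, hne₂⟩ | h' | h'
    · refine Finset.mem_insert_of_mem (Finset.mem_insert_of_mem ?_)
      exact Finset.mem_erase.2 ⟨hne₂, Finset.mem_erase.2 ⟨hne₁, Finset.mem_filter.2 ⟨Finset.mem_univ _, hc⟩⟩⟩
    · rw [h']; exact Finset.mem_insert_self _ _
    · rw [h']; exact Finset.mem_insert_of_mem (Finset.mem_insert_self _ _)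
  obtain ⟨hhit, hcolcard⟩ := rows_cover t 𝒰 h𝒰card u cols hu hUmem hcols
  obtain ⟨i₁, hi₁⟩ := hhit C₁ (Finset.mem_insert_self _ _)
  obtain ⟨i₂, hi₂⟩ := hhit C₂ (Finset.mem_insert_of_mem (Finset.mem_insert_self _ _))
  have hne : i₁ ≠ i₂ := fun h' => hC (by rw [← hi₁, ← hi₂, h'])
  have hball : ∀ R : Finset (Fin h), R.card ≤ t → R ≠ A₁ → R ≠ A₂ → ∃ i, i ≠ i₁ ∧ i ≠ i₂ ∧ u i = R := by
    intro R hR hR₁ hR₂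
    obtain ⟨i, hi⟩ := hhit R (Finset.mem_insert_of_mem (Finset.mem_insert_of_mem
      (Finset.mem_erase.2 ⟨hR₂, Finset.mem_erase.2 ⟨hR₁, Finset.mem_filter.2 ⟨Finset.mem_univ _, hR⟩⟩⟩)))
    refine ⟨i, ?_, ?_, hi⟩ <;> (rintro rfl; first | (rw [hi₁] at hi) | (rw [hi₂] at hi)) <;> (rw [← hi] at hR; omega)
  let b : Fin r → Finset (Fin h) := Function.update (Function.update u i₁ A₁) i₂ A₂
  have hb₁ : b i₁ = A₁ := by simp only [b, Function.update_of_ne hne, Function.update_self]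
  have hb₂ : b i₂ = A₂ := by simp only [b, Function.update_self]
  have hb : ∀ i, i ≠ i₁ → i ≠ i₂ → b i = u i := fun i h1 h2 => by simp only [b, Function.update_of_ne h2, Function.update_of_ne h1]
  have hub : Function.update (Function.update b i₁ C₁) i₂ C₂ = u := by
    funext i
    by_cases h2 : i = i₂
    · subst h2; rw [Function.update_self, hi₂]
    · rw [Function.update_of_ne h2]
      by_cases h1 : i = i₁
      · subst h1; rw [Function.update_self, hi₁]
      · rw [Function.update_of_ne h1, hb i h1 h2]
  have hbval : ∀ i, i ≠ i₁ → i ≠ i₂ → (b i).card ≤ t ∧ b i ≠ A₁ ∧ b i ≠ A₂ := by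
    intro i h1 h2
    rw [hb i h1 h2]
    rcases hU i with h' | h' | h'
    · exact h'
    · exact absurd (hi₁ ▸ h') (fun hh => h1 (hu hh))
    · exact absurd (hi₂ ▸ h') (fun hh => h2 (hu hh))
  have hAu : ∀ i, u i ≠ A₁ ∧ u i ≠ A₂ := by
    intro i
    rcases hU i with ⟨-, hne₁, hne₂⟩ | h' | h'
    · exact ⟨hne₁, hne₂⟩
    · rw [h']; constructor <;> (intro h''; rw [h''] at hC₁; omega)
    · rw [h']; constructor <;> (intro h''; rw [h''] at hC₂; omega)
  have hbinj : Function.Injective b := by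
    refine update_injective _ (update_injective u hu i₁ A₁ fun i => (hAu i).1) i₂ A₂ fun i' => ?_
    by_cases h' : i' = i₁
    · rw [h', Function.update_self]; exact hA
    · rw [Function.update_of_ne h']; exact (hAu i').2
  have hC₁b : ∀ i, b i ≠ C₁ := by
    intro i h'
    by_cases h1 : i = i₁
    · rw [h1, hb₁] at h'; rw [h'] at hA₁; omega
    by_cases h2 : i = i₂
    · rw [h2, hb₂] at h'; rw [h'] at hA₂; omega
    · rw [hb i h1 h2, ← hi₁] at h'; exact h1 (hu h')
  have hC₂b : ∀ i, b i ≠ C₂ := by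
    intro i h'
    by_cases h1 : i = i₁
    · rw [h1, hb₁] at h'; rw [h'] at hA₁; omega
    by_cases h2 : i = i₂
    · rw [h2, hb₂] at h'; rw [h'] at hA₂; omega
    · rw [hb i h1 h2, ← hi₂] at h'; exact h2 (hu h')
  have hF1 : (mat (tab2 N₁ N₂ ![1, 0]) (Function.update b i₁ C₁) cols).det ≠ 0 := by
    rw [hT10]
    refine swapTable'_det_ne_zero hk₁ A₁ C₁ e₁ m1 m2 m3 m4 _ cols (update_injective b hbinj i₁ C₁ hC₁b) ?_
      (by rw [hkj₁]; exact hcols)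
    intro i
    by_cases hi : i = i₁
    · right; rw [hi, Function.update_self]
    · left
      rw [Function.update_of_ne hi]
      by_cases h2 : i = i₂
      · rw [h2, hb₂]; exact ⟨by omega, Ne.symm hA⟩
      · have := hbval i hi h2; exact ⟨by rw [hkj₁]; exact this.1, this.2.1⟩
  have hF2 : (mat (tab2 N₁ N₂ ![0, 1]) (Function.update b i₂ C₂) cols).det ≠ 0 := by
    rw [hT01]
    refine swapTable'_det_ne_zero hk₂ A₂ C₂ e₂ n1 n2 n3 n4 _ cols (update_injective b hbinj i₂ C₂ hC₂b) ?_
      (by rw [hkj₂]; exact hcols)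
    intro i
    by_cases hi : i = i₂
    · right; rw [hi, Function.update_self]
    · left
      rw [Function.update_of_ne hi]
      by_cases h1 : i = i₁
      · rw [h1, hb₁]; exact ⟨by omega, hA⟩
      · have := hbval i h1 hi; exact ⟨by rw [hkj₂]; exact this.1, this.2.2⟩
  -- the trapped token of `C₂` at `x₀`: `F = {x₀, s, s'}` is forward-closed and avoids `A₁`
  have hZ : ∀ ε, (mat (tab2 N₁ N₂ ε) (Function.update b i₁ C₂) cols).det = 0 := by
    intro ε
    have hrow1 : ∀ a, a ∉ C₁ → ∀ d, d ≠ a → swapTable' e₁ a d = 0 := by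
      intro a ha d hd; by_contra h'
      exact ha (Finset.mem_sdiff.1 (swapTable'_offdiag A₁ C₁ e₁ m1 h' hd)).1
    have hrowX2 : ∀ a, a ∈ A₂ → ∀ d, d ≠ a → swapTable' e₂ a d = 0 := by
      intro a ha d hd; by_contra h'
      exact (Finset.mem_sdiff.1 (swapTable'_offdiag A₂ C₂ e₂ n1 h' hd)).2 ha
    have hbot : ∀ d, d ≠ x₀ → swapTable' e₂ x₀ d ≠ 0 → d = s ∨ d = s' := by
      intro d hd h'
      rw [← hbot₂] at h' hd
      obtain ⟨i, hi, rfl⟩ := swapTable'_bottom_row e₂ h' hd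
      by_cases hi0 : (i : ℕ) = 0
      · left
        have hi' : i = ⟨0, by omega⟩ := Fin.ext hi0
        rw [hi', hatt₂]
      · right
        have h2 : 2 ≤ k₂ := by have := i.isLt; omega
        have hi' : i = ⟨1, by omega⟩ := Fin.ext (by simp; omega)
        rw [hi', hatt₂' h2]
    refine det_eq_zero_of_trapped (tab2 N₁ N₂ ε) ({x₀, s, s'} : Finset (Fin h)) ?_ t (Function.update b i₁ C₂) cols hcolcard i₁ ?_ ?_
    · intro a ha d hd
      simp only [Finset.mem_insert, Finset.mem_singleton] at ha ⊢
      by_contra hdF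
      push Not at hdF
      apply hd
      rcases ha with rfl | rfl | rfl
      · -- row of `x₀`
        have hda : d ≠ a := hdF.1
        have h1 : swapTable' e₁ a d = 0 := hrow1 a hx₄ d hda
        have h2 : swapTable' e₂ a d = 0 := by
          by_contra h'; rcases hbot d hda h' with rfl | rfl
          · exact hdF.2.1 rfl
          · exact hdF.2.2 rfl
        simp only [tab2, N₁, N₂, h1, h2, if_neg hda]; ring
      · have hda : d ≠ a := hdF.2.1
        have h1 : swapTable' e₁ a d = 0 := hrow1 a hs₄ d hda
        have h2 : swapTable' e₂ a d = 0 := hrowX2 a hs₁ d hda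
        simp only [tab2, N₁, N₂, h1, h2, if_neg hda]; ring
      · have hda : d ≠ a := hdF.2.2
        have h1 : swapTable' e₁ a d = 0 := hrow1 a hs'₄ d hda
        have h2 : swapTable' e₂ a d = 0 := hrowX2 a hs'₁ d hda
        simp only [tab2, N₁, N₂, h1, h2, if_neg hda]; ring
    · rw [Function.update_self]
      exact ⟨x₀, Finset.mem_inter.2 ⟨hx₁, by simp⟩⟩
    · intro R hR hRF
      have hR₁ : R ≠ A₁ := by
        rintro rfl
        obtain ⟨x, hx⟩ := hRF
        rw [Finset.mem_inter] at hx
        simp only [Finset.mem_insert, Finset.mem_singleton] at hx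
        rcases hx.2 with rfl | rfl | rfl
        · exact hx₃ hx.1
        · exact hs₃ hx.1
        · exact hs'₃ hx.1
      by_cases hR₂ : R = A₂
      · refine ⟨i₂, Ne.symm hne, ?_⟩
        rw [Function.update_of_ne (Ne.symm hne), hb₂, hR₂]
      · obtain ⟨i, hi1, hi2, hi⟩ := hball R hR hR₁ hR₂
        exact ⟨i, hi1, by rw [Function.update_of_ne hi1, hb i hi1 hi2, hi]⟩
  obtain ⟨tx, htx⟩ := exists_table_of_cross_zero N₁ N₂ b cols hne C₁ C₂ hF1 hF2 (Or.inl hZ)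
  exact ⟨tx, by rw [hub] at htx; exact htx⟩

end SecondShell

end

end Summit.ValiantsHypothesis.ValiantsHypothesis.Theorems.BarrierLever.HiddenStates
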